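import Literature.MathematicalPhysics.QuantumFieldTheory.Balaban1983to89.B9Cor36DPDsCubeAtLocCfg
import Literature.MathematicalPhysics.QuantumFieldTheory.Balaban1983to89.B9Cor36GCubeLocDefectCore
import Literature.MathematicalPhysics.QuantumFieldTheory.Balaban1983to89.B9Eq395Small

/-!
# `Balaban1983to89.B9Ineq3101POneCubeAtLocCfg` — [Balaban1985BackgroundPropagators] (3.101)–(3.103) p. 414 «P₁(∂h) satisfies (3.49) with the additional small
# factor O(M⁻¹)» FOR THE CUBE LETTER `P_{□,1}(∂h_□)(Ṽ_□) = DP_□D*(Ṽ_□)·h_□ − h_□·DP_□D*(Ṽ_□)` OF (3.105), AT THE PARTITION OF RECORD `h_□ = hTY i □` AND THE LOCALISED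
# FIELD `Ṽ_□` OF THE (3.35) CUBE DATUM: ★★★ `conj b(P_{□,1}(∂h_□)(Ṽ_□)) ≺ K₁·(L·M_h)⁻¹·ℓ_□(a)⁻²·e^{−δ₁d_□(a,y)}` over the cube sequence's blocks — the cube-side input of
# family 4 of (3.105) (sub-row G-B9-LETTERS, module M5.1b-G, GAPS G-B9-07 «Σ_□ ζ_□̃P_{□,1}(∂h_□)G_□h_□»; programme FAMFOUR, FILE α-1)

T. Bałaban, *Propagators for lattice gauge theories in a background field*, Commun. Math. Phys. **99** (1985) 389–434
[`Balaban1985BackgroundPropagators`, "B9"]; [4] = T. Bałaban, *Propagators and renormalization transformations for lattice gauge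
theories. II*, Commun. Math. Phys. **96** (1984) 223–250 [`Balaban1984PropagatorsII`].

statement-level skeleton of published theorems with citation tags; proofs where landed; nothing here is a claim about the
Yang–Mills mass gap

THE PRINTED LOCUS (verbatim up to notation, held `paper:balaban1985-cmp99-background-propagators`, journal page = PDF page + 388; page owner r06).  p. 414:
«(3.101) P h = h P + P₁(∂h)», «(3.103) … P₁(∂h) …», and the sentence after (3.103): «the operator P₁(∂h) satisfies (3.49) with the additional small factor O(M⁻¹)
coming from (∂h)(Γ_{x,x′}) together with the exponential decay of DPD\*»; (3.105) p. 414 («− Σ_□ ζ_□̃ P_{□,1}(∂h_□) G_□ h_□», the fourth family of `R`); (3.49) p. 399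
(«|(DPD\*)_{μν}(x,x′)| ≦ O(1)(Lʲη)⁻²(L^{j′}η)^{−d}e^{−(1/2)δ₀d(y,y′)}»); [4] p. 247 («h_□′(x′) − h_□′(x) can be estimated by O(1)M^{−1}d(y,y′)»), (2.46) p. 231 (the scaled
distance), (2.51)–(2.52) p. 232 (block majorants and their composition).

WHY THIS FILE (cell `lit-balaban`; seat p38 gen 46; lead g34 RECEIPTS #71 2026-08-28T22:16Z «(α) = GO TO SCOPE»).  M5.7's consumer
`B9Thm310DeltaAIsUnitOfExpansion.eBlock_kernelFamilyBInv_GAY_of_localInverseCubes''` displays the remainder families `hrest` ∕ `hV'`; their FOURTH families are the cover sums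
`Σ_□ conj b((M_{ζ_□}·P1l_□·O_□·M_{h_□})^ℝ)` and `−Σ_□ conj b((M_{h_□}·O_□·P1l_□)^ℝ)` of the (R)-design letters `O_□ = locLetterBY`, `P1l_□ = locP1BY = R(u)⁻¹P_{□,1}(∂h_□)(Ṽ_□)R(u)`
(G-F2 `B9Cor36GCubeLocLetter`).  Their smallness is print's «additional small factor O(M⁻¹)»: THIS FILE proves it on the CUBE side, at the kernel level and exactly by
print's mechanism — `P_{□,1}(∂h_□) = [DP_□D*, M_{h_□}]` is the commutator of an operator with the block majorant (3.49)₄ (p38 D2a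
`B9Cor36DPDsCubeAtLocCfg.hasMajorant_conj_DPDsCubeY_at_locCfg`) and a multiplier whose profile is slowly varying in the scaled distance,
`|h_□(x′) − h_□(x)| ≤ (s_Lip∕(L·M_h))·(d_T(y,y′) + 1)` (g26 `B6Partition118KLevelTorusBinders.abs_hT_sub_le_distT`, [4] p. 247), `d_T ≤ d_□` under r05's coarsening; p21's
typed commutator engine `B9Eq395Small.hasMajorant_comm_mulOp` gives `≺ (s∕M)(1 + d_□)·K_P·ℓ⁻²e^{−δ_Pd_□}` and half of the rate pays for the linear growth (`lin_mul_exp_le`).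
Programme FAMFOUR (statement list HOME/INBOX 2026-08-28T22:28Z): α-1 = this file; α-2 `B9Cor36GCubeFamFourCore` (word identities, cube-side cores, member transfer);
α-T (source-global transfer); α-3 (cover sums + datum plug).

WHAT THIS FILE PROVES (THEOREMS; 0 `def`, 0 `def … : Prop`, 0 sorry; standard axioms).
* §1 `conj_P1CubeY_eq` (`conj b(P_{□,1}(∂h)(V)^ℝ) = conj b(DP_□D*(V)^ℝ)·mulOp h♭ − mulOp h♭·conj b(DP_□D*(V)^ℝ)`, `h♭(f,j) = h(f₋)`), `distT_blkOf_le_dist_cube`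
  (`d_T(Δ(z),Δ(w)) ≤ d_□(Δ_□(z),Δ_□(w))` — distances only shrink under coarsening, no member chart needed), ★ `abs_hBdY_hTY_sub_le_dist`
  (`|h_□♭(p′) − h_□♭(p)| ≤ s∕M + (s∕M)·d_□(Δ_□(p), Δ_□(p′))`, `s∕M = sLipT d ℓ∕(L·M_h)`).
* §2 ★★ `hasMajorant_conj_P1CubeY_of_DPDs` — GENERIC: `conj b(DP_□D*(V)^ℝ) ≺ K` over `(toB6 (geoCK i □) Rr H, blkBK i □)` ⟹
  `conj b(P_{□,1}(∂h_□)(V)^ℝ) ≺ (s∕M + (s∕M)·d_□(a,y))·K(a,y)`; ★★ `hasMajorant_conj_P1CubeY_of_DPDs_decay` — for `K = K_P·ℓ_□(a)⁻²·e^{−a_Pδ₀d_□}` and `0 < αδ₀`: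
  `≺ (s∕M)·(1 + (αδ₀)⁻¹)·K_P·ℓ_□(a)⁻²·e^{−(a_P − α)δ₀d_□}`.
* §3 ★★★ `hasMajorant_conj_P1CubeY_at_locCfg` — AT THE LOCALISED FIELD, D2a's binder block VERBATIM: there are `δ₁ > 0`, `K₁ ≥ 0`, thresholds `M₀, T₀, N₀` and `a₁ > 0`
  such that for every member above the thresholds, every cover cube, all `Rr, H`, every (3.35) cube datum `(A; Q, C, ξ, Λ)` with `sRead C Λ ≤ a₁`:
  `conj b((P_{□,1}(∂h_□)(Ṽ_□))^ℝ) ≺ K₁·(L·M_h)⁻¹·((geoCK i □).len a ^ 2)⁻¹·e^{−δ₁·d_□(a,y)}` over `(toB6 (geoCK i □) Rr H, blkBK i □)` (`δ₁ = δ_P∕2`,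
  `K₁ = sLipT·(1 + 2∕δ_P)·K_P`; the factor `(L·M_h)⁻¹ = M⁻¹` is kept EXPLICIT — it is the smallness of family 4 in the consumer's `hsmall`).

HONEST SCOPE ∕ NOT CLAIMED.  Finite operator algebra + [4] (2.51)–(2.52) bookkeeping over landed modules; block-majorant (operator) form, not print's pointwise kernel
form; `δ₁`, `K₁` existential (print: `½δ₀`, `O(1)·M⁻¹`); the (3.35) cube datum, the smallness `sRead C Λ ≤ a₁` and the member thresholds are displayed hypotheses
exactly as in D2a; the Lipschitz modulus of `h_□` is the lineage's `sLipT d ℓ` with its in-block offset `+1` (hence `s∕M + (s∕M)·d`, print's `O(M⁻¹)d(y,y′)` up to the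
offset), under the programme's side conditions (`B9Thm37CubeCoverCommutatorSizes.side_conditions`: `L ≥ 2`, `M_h ≥ 2`, `R ≥ 2L`, `P_μ ≥ 5`).  `[NormOneClass 𝔸]` in §3.
NOT here: the words `M_ζP1l_□O_□M_h`, `M_hO_□P1l_□` (α-2), the member side and the cover sums (α-T, α-3), families 2–3 of (3.105).  NOT a node discharge; no summit ∕
sub-problem statement is proved; nothing continuum ∕ OS ∕ mass-gap ∕ Clay; YM mass gap NOT proved by any of this (Track A conditional rung).  No `sorry`, no `axiom`,
no `… : Prop` fact, no `instance`, no `notation`, no `def`.  NEW file; nothing landed is modified.  `--supports stmt-QuantumFields-19200` as helper.  Net new unproved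
facts: 0.

RELATED IN THE TREE, NOT DUPLICATED (searched 2026-08-28: `rg 'HasMajorant.*P1CubeY|P1CubeY.*HasMajorant|conj b.*P1CubeY'` over `Literature/` = ∅; r06 g69 2026-08-28T22:19Z:
«a MAJORANT of P₁(∂h) is NOT in the tree under any name»; r06's R-Ker «P₁» = P₁(A) = P(U′U) − P(U) of (3.68)∕(3.77) is a HOMONYM, not this object): p33 g37
`B9Eq3105AtLetters.P1CubeY` (the letter), p38 g37 `B9Eq3104CutoffCommutators` (`cutCommR`, member-level `P1Y`), p21 `B9Eq395Small.hasMajorant_comm_mulOp` ∕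
`lin_mul_exp_le` (the engine, for the (3.95) commutators), g26 `B6Partition118KLevelTorusBinders.abs_hT_sub_le_distT`, r05 `B9CubeCoarsening.geomT_dist_coarsen_le`,
p38 D2a `B9Cor36DPDsCubeAtLocCfg` — all USED BY NAME.
-/

noncomputable section

namespace Literature.MathematicalPhysics.QuantumFieldTheory.Balaban1983to89.B9Ineq3101POneCubeAtLocCfg

open B6RandomWalk (HasMajorant hasMajorant_mono)
open B9Thm34Ext (toB6)
open B9Thm37Sum (mulOp mulOp_apply)
open B9Eq352DivFormLetters (conj conj_sub)
open B9Eq395Small (hasMajorant_comm_mulOp lin_mul_exp_le)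
open B9Eq39Adjoint (covD)
open B6KLevelCensusIndexV1 (KIdx kGeo)
open B6Cover236MultiLevelBlocks (cubes)
open B6GlobalChartV1 (PV boxEquiv)
open B6Geom246MultiLevelBox (blkOf)
open B6Geom246MultiLevelTorus (geomT bondT)
open B9BackgroundsKLevelV1 (shiftsV1)
open B9Eq360DeltaPrimeAY (AfldY)
open B9Eq360DeltaPrimeACubeY (blkCubeY blkCubeY_apply)
open B9CubeLettersOpsL0 (cubeFamY)
open B9CubeLettersBondOpsL0 (BlkCubeY)
open B9CubeGeometryInputs (geoCK geoCK_dist_axioms geoCK_len_pos RM1)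
open B9CubeCoarsening (coarsen_blkOf geomT_dist_coarsen_le)
open B9Cor35GCubeInputsAtOne (blkBK)
open B9Cor36CubeCutoffs (SC NearC locCfgY)
open B9Thm37CubeCoverCommutators (cutMulY cutMulY_apply hTY hTY_apply)
open B9Thm37CubeCoverCommutatorSizes (side_conditions)
open B9Thm39CinvTorusRegular (conj_cutMulY)
open B9Eq3104CutoffCommutators (hBdY hBdY_apply cutCommR)
open B9Eq3105AtLetters (DPDsCubeY P1CubeY)
open B6Partition118KLevelTorusBinders (sLipT sLipT_nonneg abs_hT_sub_le_distT)
open B9Cor36GCubeWindows (sRead)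
open B9Cor36DPDsCubeAtLocCfg (hasMajorant_conj_DPDsCubeY_at_locCfg)
open Node00 (SiteY CfgY FBondY SiteParY toKT parSymY)
open Node00.OpsYNablaBridge (chartY)

variable {d ℓ : ℕ} {hd : 1 ≤ d + 1} {hL : Odd (ℓ + 1) ∧ 1 < ℓ + 1} {b₀ b₁ : ℝ}
variable {𝔸 : Type} [NormedRing 𝔸] [NormedAlgebra ℂ 𝔸] [CompleteSpace 𝔸]
variable {ι : Type} [Fintype ι] (b : Module.Basis ι ℝ 𝔸)

/-! ## §1  `conj b(P_{□,1}(∂h)) = [conj b(DP_□D*), mulOp h♭]`; the profile of `h_□` is slowly varying in the cube sequence's scaled distance -/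

section Algebra

variable (i : KIdx d ℓ hd hL b₀ b₁) (c : ↥(cubes (toKT i).D.toDomains)) (par : SiteParY 𝔸 i)

/-- ★ **(3.101) IN REAL COORDINATES**: `conj b(P_{□,1}(∂h)(V)^ℝ) = conj b(DP_□D*(V)^ℝ)·mulOp h♭ − mulOp h♭·conj b(DP_□D*(V)^ℝ)`, `h♭(f, j) := h(f₋)` — the letter
`P_{□,1}(∂h) = DP_□D*·h − h·DP_□D*` (p33's `P1CubeY = −[h](DP_□D*)`) is a commutator with a multiplication operator (r06's `conj_mul`, `conj_sub`, `conj_cutMulY`).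
[cite: Balaban1985BackgroundPropagators, (3.101) p.414, (3.105) p.414; Balaban1984PropagatorsII, (2.52) p.232] -/
theorem conj_P1CubeY_eq (h : SiteY i → ℝ) (V : CfgY 𝔸 i) :
    conj b ((P1CubeY i c h par V).restrictScalars ℝ) =
      conj b ((DPDsCubeY i c par V).restrictScalars ℝ) * mulOp (fun p : FBondY i × ι => hBdY i h p.1) -
        mulOp (fun p : FBondY i × ι => hBdY i h p.1) * conj b ((DPDsCubeY i c par V).restrictScalars ℝ) := by
  have e : ((P1CubeY i c h par V).restrictScalars ℝ : Module.End ℝ (FBondY i → 𝔸)) =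
      (DPDsCubeY i c par V).restrictScalars ℝ * (cutMulY (𝔸 := 𝔸) (hBdY i h)).restrictScalars ℝ -
        (cutMulY (𝔸 := 𝔸) (hBdY i h)).restrictScalars ℝ * (DPDsCubeY i c par V).restrictScalars ℝ := by
    refine LinearMap.ext fun v => ?_
    simp only [P1CubeY, cutCommR, LinearMap.restrictScalars_apply, LinearMap.sub_apply, LinearMap.comp_apply, Module.End.mul_apply, neg_sub]
  rw [e, conj_sub, B9Eq352DivFormLetters.conj_mul, B9Eq352DivFormLetters.conj_mul, conj_cutMulY]

/-- **DISTANCES ONLY SHRINK UNDER COARSENING, WITHOUT A MEMBER CHART**: the member's torus block distance of two sites is at most the cube sequence's scaled distance of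
their cube blocks (r05's `geomT_dist_coarsen_le`, `coarsen_blkOf`). [cite: Balaban1984PropagatorsII, (2.46) p.231; Balaban1985BackgroundPropagators, p.408 («Ω_n(□) ⊂ Ω_n»), (3.89) p.409] -/
theorem distT_blkOf_le_dist_cube (z w : SiteY i) :
    (geomT (toKT i).D).dist (blkOf (toKT i).D.toDomains z) (blkOf (toKT i).D.toDomains w) ≤ (geoCK i c).dist (blkCubeY i c z) (blkCubeY i c w) := by
  have h := geomT_dist_coarsen_le (D := (toKT i).D) (q := c) (hL := hL.1) (hM := B9CubeLettersOpsL0.oddMh i) (toKT i).hMh (toKT i).hP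
    (blkCubeY i c z) (blkCubeY i c w)
  rw [blkCubeY_apply, blkCubeY_apply] at h
  unfold cubeFamY at h
  rw [coarsen_blkOf, coarsen_blkOf] at h
  exact h

omit [Fintype ι] in
/-- ★ **THE PROFILE OF `h_□` IS SLOWLY VARYING ON THE CUBE SEQUENCE's BLOCKS**: `|h_□(p′₋) − h_□(p₋)| ≤ s∕M + (s∕M)·d_□(Δ_□(p), Δ_□(p′))`, `s∕M := sLipT d ℓ∕(L·M_h)` —
[4] p. 247 «h_□′(x′) − h_□′(x) can be estimated by O(1)M⁻¹d(y,y′)» at the partition of record (g26 `abs_hT_sub_le_distT`, the in-block offset `+1` kept), with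
`d_T ≤ d_□`. [cite: Balaban1984PropagatorsII, p.247, (2.46) p.231, (2.36) p.229; Balaban1985BackgroundPropagators, (3.87)–(3.88) p.409, p.414 («O(M⁻¹) coming from (∂h)»)] -/
theorem abs_hBdY_hTY_sub_le_dist (p p' : FBondY i × ι) :
    |hBdY i (hTY i c) p'.1 - hBdY i (hTY i c) p.1| ≤
      sLipT d ℓ / (((ℓ : ℝ) + 1) * i.Mh) + sLipT d ℓ / (((ℓ : ℝ) + 1) * i.Mh) * (geoCK i c).dist (blkBK i c p) (blkBK i c p') := by
  obtain ⟨hℓ, hMh, hR, hP5⟩ := side_conditions i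
  have hs : 0 ≤ sLipT d ℓ / (((ℓ : ℝ) + 1) * i.Mh) := div_nonneg (sLipT_nonneg d ℓ) (by positivity)
  have h := abs_hT_sub_le_distT (D := i.D) hℓ hMh hR hP5 c (chartY i p.1.src) (chartY i p'.1.src)
  rw [hBdY_apply, hBdY_apply, hTY_apply, hTY_apply]
  have hd : ((bondT i.D).dist (blkOf i.D.toDomains (chartY i p.1.src)) (blkOf i.D.toDomains (chartY i p'.1.src)) : ℝ) ≤
      (geoCK i c).dist (blkBK i c p) (blkBK i c p') := distT_blkOf_le_dist_cube i c (chartY i p.1.src) (chartY i p'.1.src)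
  calc |B6Partition118KLevelTorus.hT i.D c (chartY i p'.1.src) - B6Partition118KLevelTorus.hT i.D c (chartY i p.1.src)|
      ≤ sLipT d ℓ / (((ℓ : ℝ) + 1) * i.Mh) *
          (((bondT i.D).dist (blkOf i.D.toDomains (chartY i p.1.src)) (blkOf i.D.toDomains (chartY i p'.1.src)) : ℝ) + 1) := h
    _ ≤ sLipT d ℓ / (((ℓ : ℝ) + 1) * i.Mh) * ((geoCK i c).dist (blkBK i c p) (blkBK i c p') + 1) :=
        mul_le_mul_of_nonneg_left (add_le_add hd le_rfl) hs
    _ = _ := by ring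

end Algebra

/-! ## §2  The commutator majorant: `conj b(P_{□,1}(∂h_□)(V)) ≺ (s∕M)(1 + d_□)·K` from any block majorant `K` of `conj b(DP_□D*(V))` -/

section Generic

variable (i : KIdx d ℓ hd hL b₀ b₁) (c : ↥(cubes (toKT i).D.toDomains)) (par : SiteParY 𝔸 i)

/-- ★★ **THE (3.101)–(3.103) MECHANISM, GENERIC KERNEL**: if `conj b(DP_□D*(V)^ℝ) ≺ K` over the cube sequence's blocks `(toB6 (geoCK i □) Rr H, blkBK i □)`, then
`conj b(P_{□,1}(∂h_□)(V)^ℝ) ≺ (s∕M + (s∕M)·d_□(a,y))·K(a,y)` — the kernel of the commutator is `(DP_□D*)(x,x′)(h_□(x′) − h_□(x))` and the profile increment is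
`≤ (s∕M)(1 + d_□)` (p21's `hasMajorant_comm_mulOp`).  Any background `V`, any transporters.
[cite: Balaban1985BackgroundPropagators, (3.101)–(3.103) p.414 («additional small factor O(M⁻¹) coming from (∂h)(Γ_{x,x′}) together with the exponential decay of DPD\*»); Balaban1984PropagatorsII, p.247, (2.51)–(2.52) p.232] -/
theorem hasMajorant_conj_P1CubeY_of_DPDs (V : CfgY 𝔸 i) (Rr : ℝ) (H : Prop) {K : BlkCubeY i c → BlkCubeY i c → ℝ}
    (hP : HasMajorant (g := toB6 (geoCK i c) Rr H) (blkBK i c) (conj b ((DPDsCubeY i c par V).restrictScalars ℝ)) K) :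
    HasMajorant (g := toB6 (geoCK i c) Rr H) (blkBK i c) (conj b ((P1CubeY i c (hTY i c) par V).restrictScalars ℝ))
      (fun a y => (sLipT d ℓ / (((ℓ : ℝ) + 1) * i.Mh) + sLipT d ℓ / (((ℓ : ℝ) + 1) * i.Mh) * (geoCK i c).dist a y) * K a y) := by
  have hs : 0 ≤ sLipT d ℓ / (((ℓ : ℝ) + 1) * i.Mh) := div_nonneg (sLipT_nonneg d ℓ) (by positivity)
  rw [conj_P1CubeY_eq]
  exact hasMajorant_comm_mulOp (G := toB6 (geoCK i c) Rr H) (blkBK i c) hP (fun p : FBondY i × ι => hBdY i (hTY i c) p.1) _ _ hs hs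
    (geoCK_dist_axioms i c Rr H).1 (abs_hBdY_hTY_sub_le_dist i c)

/-- ★★ **THE DECAY SHAPE**: from `conj b(DP_□D*(V)^ℝ) ≺ K_P·ℓ_□(a)⁻²·e^{−a_Pδ₀d_□}` (D2a's shape, rate quoted as `a_P·δ₀`) and `0 < αδ₀`:
`conj b(P_{□,1}(∂h_□)(V)^ℝ) ≺ (s∕M)·(1 + (αδ₀)⁻¹)·K_P·ℓ_□(a)⁻²·e^{−(a_P − α)δ₀d_□}` — a part `α` of the rate pays for the linear growth of the profile increment
(p21's `lin_mul_exp_le`). [cite: Balaban1985BackgroundPropagators, (3.101)–(3.103) p.414, (3.49) p.399; Balaban1984PropagatorsII, p.247, (2.51)–(2.52) p.232] -/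
theorem hasMajorant_conj_P1CubeY_of_DPDs_decay (V : CfgY 𝔸 i) (Rr : ℝ) (H : Prop) (aP δ₀ α : ℝ) {KP : ℝ} (hKP : 0 ≤ KP) (hαδ : 0 < α * δ₀)
    (hP : HasMajorant (g := toB6 (geoCK i c) Rr H) (blkBK i c) (conj b ((DPDsCubeY i c par V).restrictScalars ℝ))
      (fun a y => KP * ((geoCK i c).len a ^ 2)⁻¹ * Real.exp (-(aP * δ₀ * (geoCK i c).dist a y)))) :
    HasMajorant (g := toB6 (geoCK i c) Rr H) (blkBK i c) (conj b ((P1CubeY i c (hTY i c) par V).restrictScalars ℝ))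
      (fun a y => sLipT d ℓ / (((ℓ : ℝ) + 1) * i.Mh) * (1 + (α * δ₀)⁻¹) * KP * ((geoCK i c).len a ^ 2)⁻¹ *
        Real.exp (-((aP - α) * δ₀ * (geoCK i c).dist a y))) := by
  have hs : 0 ≤ sLipT d ℓ / (((ℓ : ℝ) + 1) * i.Mh) := div_nonneg (sLipT_nonneg d ℓ) (by positivity)
  have hdnn := (geoCK_dist_axioms i c Rr H).1
  refine hasMajorant_mono (g := toB6 (geoCK i c) Rr H) _ (hasMajorant_conj_P1CubeY_of_DPDs b i c par V Rr H hP) fun a y => ?_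
  have hw : 0 ≤ KP * ((geoCK i c).len a ^ 2)⁻¹ := mul_nonneg hKP (inv_nonneg.2 (sq_nonneg _))
  have key := lin_mul_exp_le (sLipT d ℓ / (((ℓ : ℝ) + 1) * i.Mh)) (sLipT d ℓ / (((ℓ : ℝ) + 1) * i.Mh)) aP α δ₀ ((geoCK i c).dist a y) hs hs hαδ (hdnn a y)
  calc (sLipT d ℓ / (((ℓ : ℝ) + 1) * i.Mh) + sLipT d ℓ / (((ℓ : ℝ) + 1) * i.Mh) * (geoCK i c).dist a y) *
        (KP * ((geoCK i c).len a ^ 2)⁻¹ * Real.exp (-(aP * δ₀ * (geoCK i c).dist a y)))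
      = (KP * ((geoCK i c).len a ^ 2)⁻¹) * ((sLipT d ℓ / (((ℓ : ℝ) + 1) * i.Mh) + sLipT d ℓ / (((ℓ : ℝ) + 1) * i.Mh) * (geoCK i c).dist a y) *
          Real.exp (-(aP * δ₀ * (geoCK i c).dist a y))) := by ring
    _ ≤ (KP * ((geoCK i c).len a ^ 2)⁻¹) * ((sLipT d ℓ / (((ℓ : ℝ) + 1) * i.Mh) + sLipT d ℓ / (((ℓ : ℝ) + 1) * i.Mh) * (α * δ₀)⁻¹) *
          Real.exp (-((aP - α) * δ₀ * (geoCK i c).dist a y))) := mul_le_mul_of_nonneg_left key hw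
    _ = _ := by ring

end Generic

/-! ## §3  ★★★ At the localised field `Ṽ_□` of the (3.35) cube datum: `conj b(P_{□,1}(∂h_□)(Ṽ_□)) ≺ K₁·(L·M_h)⁻¹·ℓ_□⁻²·e^{−δ₁d_□}` -/

section DefY

variable [NormOneClass 𝔸] [DecidableEq ι]

/-- ★★★ **«P₁(∂h) SATISFIES (3.49) WITH THE ADDITIONAL SMALL FACTOR O(M⁻¹)» FOR THE CUBE LETTER AT THE LOCALISED FIELD**: there are `δ₁ > 0`, `K₁ ≥ 0`, thresholds
`M₀, T₀, N₀` and `a₁ > 0` (functions of `d, L, M₂, Σ‖b_j‖`) such that for every member above the thresholds, every cover cube `□`, all `Rr, H` and every (3.35) cube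
datum `(A; Q, C, ξ, Λ)` (p21's readings) with `sRead C Λ ≤ a₁`:
`conj b((P_{□,1}(∂h_□)(Ṽ_□))^ℝ) ≺ K₁·(L·M_h)⁻¹·((geoCK i □).len a ^ 2)⁻¹·e^{−δ₁·d_□(a,y)}` over `(toB6 (geoCK i □) Rr H, blkBK i □)`, at `h_□ = hTY i □`, `parS := parSymY i`,
`Ṽ_□ = locCfgY i □ η A` — D2a's (3.49)₄ majorant of `conj b(DP_□D*(Ṽ_□))` through §2 (`α = δ_P∕2`: `δ₁ = δ_P∕2`, `K₁ = sLipT·(1 + (δ_P∕2)⁻¹)·K_P`).  The binder block is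
D2a's VERBATIM; the factor `(L·M_h)⁻¹` is print's `M⁻¹`, kept explicit for the consumer's smallness.
[cite: Balaban1985BackgroundPropagators, (3.101)–(3.103) p.414, (3.105) p.414, (3.49) p.399, p.403 (before (3.68)), Cor. 3.6 p.408 l.1–10, p.409 l.1–5; Balaban1984PropagatorsII, p.247, (2.46) p.231, (2.51)–(2.52) p.232] -/
theorem hasMajorant_conj_P1CubeY_at_locCfg (hℓ : 1 ≤ ℓ) (M₂ : ℝ) (hM₂ : 0 ≤ M₂) (hrepr : ∀ (v : 𝔸) (j : ι), |b.repr v j| ≤ M₂ * ‖v‖) :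
    ∃ δ₁ K₁ M₀ T₀ : ℝ, ∃ N₀ : ℕ, 0 < δ₁ ∧ 0 ≤ K₁ ∧ ∃ a₁ : ℝ, 0 < a₁ ∧
    ∀ (i : KIdx d ℓ hd hL b₀ b₁) (c : ↥(cubes (toKT i).D.toDomains)) (Rr : ℝ) (H : Prop),
      M₀ ≤ ((ℓ : ℝ) + 1) * (toKT i).Mh → N₀ + 1 ≤ (toKT i).R * ((ℓ + 1) * (toKT i).Mh) → T₀ ≤ RM1 i →
    ∀ (A : AfldY 𝔸 i) (Q : Set (Site (PV d ℓ i.m i.K hd hL) 0)) (C ξ Λ : ℝ),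
      0 ≤ C → 0 < ξ → 1 ≤ Λ → ξ ≤ 5 * (SC i c : ℝ) * (kGeo i).eta → LatticeNorms.scaleLen ((ℓ : ℝ) + 1) (kGeo i).eta (c.1.1 + 1) ≤ Λ * ξ →
      (∀ x : Site (PV d ℓ i.m i.K hd hL) 0, NearC i c (35 * SC i c / 8 + 1) (boxEquiv i.hN x).1 → x ∈ Q) →
      (∀ κ, ∀ x ∈ Q, ‖A κ x‖ ≤ C * ξ⁻¹) →
      (∀ μ ν, ∀ x ∈ Q, ‖(((kGeo i).eta : ℂ)⁻¹) • covD (shiftsV1 (PV d ℓ i.m i.K hd hL)) (fun _ _ => (1 : 𝔸ˣ)) μ (A ν) x‖ ≤ C * (ξ ^ 2)⁻¹) →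
      sRead C Λ ≤ a₁ →
      HasMajorant (g := toB6 (geoCK i c) Rr H) (blkBK i c)
        (conj b ((P1CubeY i c (hTY i c) (parSymY i) (locCfgY i c (kGeo i).eta A)).restrictScalars ℝ))
        (fun a y => K₁ * (((ℓ : ℝ) + 1) * (i.Mh : ℝ))⁻¹ * ((geoCK i c).len a ^ 2)⁻¹ * Real.exp (-(δ₁ * (geoCK i c).dist a y))) := by
  obtain ⟨δP, KP, M₀, T₀, N₀, hδP, hKP, a₁, ha₁, HP⟩ := hasMajorant_conj_DPDsCubeY_at_locCfg b hℓ M₂ hM₂ hrepr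
  refine ⟨δP / 2, sLipT d ℓ * (1 + (1 / 2 * δP)⁻¹) * KP, M₀, T₀, N₀, by positivity,
    mul_nonneg (mul_nonneg (sLipT_nonneg d ℓ) (by positivity)) hKP, a₁, ha₁,
    fun i c Rr H hM hN hT A Q C ξ Λ hC hξ hΛ hξS hΛξ hQ hA hdA hs => ?_⟩
  have hP := HP i c Rr H hM hN hT A Q C ξ Λ hC hξ hΛ hξS hΛξ hQ hA hdA hs
  have hP' : HasMajorant (g := toB6 (geoCK i c) Rr H) (blkBK i c)
      (conj b ((DPDsCubeY i c (parSymY i) (locCfgY i c (kGeo i).eta A)).restrictScalars ℝ))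
      (fun a y => KP * ((geoCK i c).len a ^ 2)⁻¹ * Real.exp (-(1 * δP * (geoCK i c).dist a y))) :=
    hasMajorant_mono (g := toB6 (geoCK i c) Rr H) _ hP fun a y => by rw [one_mul]
  refine hasMajorant_mono (g := toB6 (geoCK i c) Rr H) _
    (hasMajorant_conj_P1CubeY_of_DPDs_decay b i c (parSymY i) _ Rr H 1 δP (1 / 2) hKP (by positivity) hP') fun a y => le_of_eq ?_
  have hL : ((ℓ : ℝ) + 1) * (i.Mh : ℝ) ≠ 0 := by
    have : (1 : ℝ) ≤ i.Mh := by exact_mod_cast le_trans (by norm_num) (side_conditions i).2.1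
    positivity
  rw [div_eq_mul_inv (sLipT d ℓ)]
  congr 1
  · ring
  · congr 1; ring

end DefY

end Literature.MathematicalPhysics.QuantumFieldTheory.Balaban1983to89.B9Ineq3101POneCubeAtLocCfg

end
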